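import Summits.ABC.IUTFork.Repair.RHSigmaSignedRemainder
import Summits.ABC.IUTFork.Repair.RHSigmaStrataEqInvariance
import HarnessLib

/-!
# R-H ROUND 3 socket (genuine bed): THE UNIVERSAL T-LEVEL ADAPTER «`StatementUpTo ε` at the chosen bed ⟹ `−|log(q)|(T) ≤ −|log(Θ)|(T) + ε`» —
# every generic door (licence, weighted, minorant, partial credit, signed remainder) becomes the [NUMΣ-C] binder of the abc / exponent ends

abc-iut cell, rung LADDER-ABC:A2.RESCUE.H, R-H seat abc-iut-rh2-q2-eq (gen 3). PROOF-ONLY sequel (0 definitions, 0 `Prop` facts, no instance, no notation)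
of this seat's `RHSigmaStrataEq.lean` (p470233 §1: `GenuineK.cor312UpTo_of_licenceOn`), `RHSigmaStrataEqInvariance.lean` (p476845:
`cor312UpTo_offRemainder_empty_chosen`), `RHSigmaLicenceSigned.lean` (p479556: `statementUpTo_signedRemainder`) and `RHSigmaSignedRemainder.lean` (p480491: THE
WEIGHTED DOOR); companion `RHSigmaCellCredit.lean` (same date: the generic PARTIAL-CREDIT door). Purpose (rh-lead g2 ROUND-3 START-HERE v1.0 §2: round-3
candidates name «the door theorem» that carries their cell-level law to F5/F5κ): ONE adapter so that EVERY generic door `… ⟹ StatementUpTo P ε` of the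
tree lands, at the bed of every abc-end of record, on abc-iut-rh2-q2-cond's binder [NUMΣ-C] «`T.negAbsLogQ ≤ T.negLogTheta + ε P l T`» of
`Cor312Slack.thm110LegendreWith_of_cor312Slack_mu_content_hregC` (F4½, exponent `1/μ₀`) / `Cor312Slack.ABC_of_cor312Slack_content_hregC` (no loss) with
`ε :=` the door's certified slack — leaving the relative tolerance [MU-C] «`ε ≤ (1−μ₀)·T.gap + Tol(P,l)`» as the ONE content binder.

WHAT IS TYPED:
* §1 AT THE GENUINE `K`-LEVEL DATUM (realising ideles, every context of abc-iut-c312-7's sharp print-normalised setting): **`GenuineK.cor312UpTo_of_statementUpTo`**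
  — `StatementUpTo (setting) ε ⟹ I.negAbsLogQ ≤ I.negLogTheta + ε` for every genuine volume input `I` of `D` (gen-0's `GenuineK.cor312UpTo_of_licenceOn` with
  the licence replaced by ANY certified slack; q-side abc-iut-c312-7 `negLogQ_settingPrVolSharp`, Θ-side abc-iut-s2-p6 `negLogTheta_settingPrVolSharp_pilotDataOfK_le_genuine`).
* §2 T-LEVEL at the CHOSEN realising ideles: **`cor312UpTo_of_statementUpTo_chosen`** — «`StatementUpTo (chosen setting of T) ε ⟹ T.negAbsLogQ ≤
  T.negLogTheta + ε`» for every `T : Cor22.ThetaVolumeDatumAt P l`, every context, every `ε`; instances **`cor312UpTo_weightedTrivialMass_of_weightedDeficit_nonpos_chosen`**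
  (THE WEIGHTED DOOR at the datum: `ω ≤ 1`, `weightedDeficit ≤ 0 ⟹ T.negAbsLogQ ≤ T.negLogTheta + weightedTrivialMass ω`) and **`cor312UpTo_signedRemainder_chosen`**
  (hypothesis-free, the LEAST slack `D(T) = R_∅(T) − C(T)`: sharper than p476845's `R_∅(T)` form by exactly the credit).
HONEST FRAMING: implications about OUR typed objects; the doors' hypotheses are ASSUMPTION SHAPES, never asserted for any datum or candidate; nothing here
asserts that abc is proved or refuted, or that [IUTchIII] Cor. 3.12 holds or fails at any datum, or takes a side on any author (Mochizuki / Scholze–Stix /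
Joshi / Dupuy–Hilado); typed ≠ proved; instantiated ≠ endorsed. [claim: Mochizuki2012, status: disputed] for every IUT locution.
[cite: Mochizuki2012, IUTchIII Cor. 3.12 p. 173–174, Prop. 3.9 (i)(iii) p. 116; IUTchI Ex. 3.2 (iv) p. 71] [cite: DupuyHilado2025, §3.4, §3.9]
-/

noncomputable section

open Set Function NumberField IsDedekindDomain

/-! ## §1. At the genuine `K`-level datum with realising ideles: ANY certified slack ⟹ the datum's weakened Corollary -/

namespace Summit.ABC.IUTFork.Repair.RH.SigmaStrataEq

open Summit.ABC.IUTFork.Thm311 Summit.ABC.IUTFork.Thm311.Real Summit.ABC.IUTFork.Cor312 Summit.ABC.IUTFork.Cor312.Setting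
  Summit.ABC.IUTFork.Cor312Vol Summit.ABC.IUTFork.Cor312Prov Literature.IUT.LogThetaLattice Literature.IUT.LogVolume
  Literature.IUT.HodgeTheaters Literature.IUT.LogVolume.ThetaData
  Summit.ABC.IUTFork.Repair.RH.SigmaLicence Summit.ABC.IUTFork.Repair.RH.SigmaMass

section Datum

variable {F K Fbar : Type} [Field F] [NumberField F] [Field K] [NumberField K] [Algebra F K] [Field Fbar]
  [Algebra F Fbar] [Algebra K Fbar] {E : WeierstrassCurve F} [E.IsElliptic] {l : ℕ} {Pb : BadPlacePredicates K}
  (D : InitialThetaData F K Fbar E l Pb) {I : ThetaVolumeInput (fieldOfModuli E) K}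
  (M : Type) [Field M] [NumberField M]
  (archPk : ∀ (j : (thetaIndex (pilotDataOfK D K)).Label) (vQ : (thetaIndex (pilotDataOfK D K)).VQ),
    Set ((logShellsDH (pilotDataOfK D K) (analyticLogv K)).Packet j vQ))
  (archSub : ∀ (j : (thetaIndex (pilotDataOfK D K)).Label) (v : (thetaIndex (pilotDataOfK D K)).V),
    Set ((logShellsDH (pilotDataOfK D K) (analyticLogv K)).Packet j ((thetaIndex (pilotDataOfK D K)).over v)))
  (Ψ : ℤ → ∀ v : (thetaIndex (pilotDataOfK D K)).V, v ∈ (thetaIndex (pilotDataOfK D K)).Vbad →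
    Set ((logShellsDH (pilotDataOfK D K) (analyticLogv K)).StarPacket v))
  (act : ℤ → ∀ v : (thetaIndex (pilotDataOfK D K)).V, v ∈ (thetaIndex (pilotDataOfK D K)).Vbad →
    (logShellsDH (pilotDataOfK D K) (analyticLogv K)).StarPacket v →
      Module.End ℚ ((logShellsDH (pilotDataOfK D K) (analyticLogv K)).StarPacket v))
  (Mmod : ℤ → ∀ j : (thetaIndex (pilotDataOfK D K)).LabelStar,
    Set ((logShellsDH (pilotDataOfK D K) (analyticLogv K)).GlobalPacket j.1))
  (region : ℤ → ∀ j : (thetaIndex (pilotDataOfK D K)).LabelStar, FinDivisor M → ∀ vQ : (thetaIndex (pilotDataOfK D K)).VQ,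
    Set ((logShellsDH (pilotDataOfK D K) (analyticLogv K)).Packet j.1 vQ))
  (n : ℤ) {HT : Type} {LogLink : HT → HT → Type} {IsFull : ∀ {s t : HT}, LogLink s t → Prop}
  (lat : LGPGaussianLogThetaLattice LogLink IsFull)
  {Frd : Type} {IsoF : Frd → Frd → Type} {Ob : Frd → Type} {realify : Frd → Frd} {Strip : Type}
  {IsoS : Strip → Strip → Type}
  {Mv : ∀ v : (thetaIndex (pilotDataOfK D K)).V, v ∈ (thetaIndex (pilotDataOfK D K)).Vbad → Type} [∀ v h, Monoid (Mv v h)]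
  (sig : GlobalLGPFrobenioidSignature (thetaIndex (pilotDataOfK D K)).lstar (thetaIndex (pilotDataOfK D K)).V
    (· ∈ (thetaIndex (pilotDataOfK D K)).Vbad) Frd IsoF Ob realify Strip IsoS Mv)
  (split : SplittingMonoids Mv) {ObΔ : Type}
  {N : ∀ v : (thetaIndex (pilotDataOfK D K)).V, v ∈ (thetaIndex (pilotDataOfK D K)).Vbad → Type} [∀ v h, Monoid (N v h)]
  (qData : QPilotData ObΔ N)
  (tq : ∀ (pp : Nat.Primes) (x : (thetaIndex (pilotDataOfK D K)).Fibre (.inr pp)),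
    haveI : Fact (pp : ℕ).Prime := ⟨pp.2⟩; kOf (pilotDataOfK D K) pp.1 x)
  (t : ∀ (pp : Nat.Primes) (_ : Fin (pilotDataOfK D K).lstar) (x : (thetaIndex (pilotDataOfK D K)).Fibre (.inr pp)),
    haveI : Fact (pp : ℕ).Prime := ⟨pp.2⟩; kOf (pilotDataOfK D K) pp.1 x)
  (htq0 : ∀ pp x, tq pp x ≠ 0)
  (htq1 : ∀ (pp : Nat.Primes) (x : (thetaIndex (pilotDataOfK D K)).Fibre (.inr pp)),
    haveI : Fact (pp : ℕ).Prime := ⟨pp.2⟩; placeOf (pilotDataOfK D K) pp.1 x ∉ (pilotDataOfK D K).S → ‖tq pp x‖ = 1)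

/-- **ANY CERTIFIED SLACK AT THE DATUM: «Cor. 3.12 up to `ε`» at the genuine `K`-level setting ⟹ `I.negAbsLogQ ≤ I.negLogTheta + ε`.** At the genuine
pilot datum `pilotDataOfK D K`, for EVERY context of abc-iut-c312-7's sharp print-normalised setting and ALL realising ideles (`ht0 htq hT`; the unit condition `ht1` off `S` is not needed here):
`StatementUpTo (setting) ε` gives the number-level weakened Corollary for every genuine volume input `I` OF `D` — q-side DISCHARGED by abc-iut-c312-7
`negLogQ_settingPrVolSharp` ∘ `absLogq_eq_ndeg_qPilot_pilotDataOfK` ∘ abc-iut-c312-8 `negAbsLogQ_eq_neg_absLogq_of_isVolumeInputOf`, Θ-side by abc-iut-s2-p6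
`negLogTheta_settingPrVolSharp_pilotDataOfK_le_genuine` (realising Θ-ideles). This seat's gen-0 `GenuineK.cor312UpTo_of_licenceOn` / `GenuineK.cor312UpTo_sigmaNu`
are the instances `ε := R_σ` / `R_{Σ₄}`; here `ε` is whatever a door certifies (weighted, minorant, partial credit, signed remainder). «holds AS TYPED for
OUR hull»; no side taken. [cite: Mochizuki2012, IUTchIII Cor. 3.12 p. 173–174; IUTchI Ex. 3.2 (iv) p. 71] [claim: Mochizuki2012, status: disputed] -/
theorem GenuineK.cor312UpTo_of_statementUpTo (hI : ThetaData.IsVolumeInputOf D I) (ht0 : ∀ pp i x, t pp i x ≠ 0)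
    (htq : ∀ (pp : Nat.Primes) (x : (thetaIndex (pilotDataOfK D K)).Fibre (.inr pp)),
      haveI : Fact (pp : ℕ).Prime := ⟨pp.2⟩
      Real.log ‖tq pp x‖ = -((pilotDataOfK D K).qPilot (placeOf (pilotDataOfK D K) pp.1 x)) *
        logNorm K (placeOf (pilotDataOfK D K) pp.1 x) / localDegree K (placeOf (pilotDataOfK D K) pp.1 x))
    (hT : ∀ (pp : Nat.Primes) (i : Fin (pilotDataOfK D K).lstar) (x : (thetaIndex (pilotDataOfK D K)).Fibre (.inr pp)),
      haveI : Fact (pp : ℕ).Prime := ⟨pp.2⟩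
      Real.log ‖t pp i x‖ = -((pilotDataOfK D K).thetaPilot i (placeOf (pilotDataOfK D K) pp.1 x)) *
        logNorm K (placeOf (pilotDataOfK D K) pp.1 x) / localDegree K (placeOf (pilotDataOfK D K) pp.1 x))
    {ε : ℝ}
    (hst : StatementUpTo
      (settingPrVolSharp (pilotDataOfK D K) (logvAnalytic_analyticLogv (F := K)) M archPk archSub Ψ act Mmod region n lat sig split
        qData tq t htq0 htq1) ε) :
    I.negAbsLogQ ≤ I.negLogTheta + ε := by
  -- the q-side: `−|log(q)|` of the setting `= −deĝ_K(P_q(pilotDataOfK D K)) = −|log(q)|` of `D` `= I.negAbsLogQ`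
  have hq := negLogQ_settingPrVolSharp (pilotDataOfK D K) (logvAnalytic_analyticLogv (F := K)) M archPk archSub Ψ act Mmod region n lat sig
    split qData t tq htq0 htq1 htq
  rw [← absLogq_eq_ndeg_qPilot_pilotDataOfK D K] at hq
  obtain ⟨-, hle⟩ := hst
  rw [hq] at hle
  -- the Θ-side: realising Θ-ideles give `−|log(Θ)|(setting) ≤ I.negLogTheta`
  have hΘ := negLogTheta_settingPrVolSharp_pilotDataOfK_le_genuine D M archPk archSub Ψ act Mmod region n lat sig split qData tq t htq0
    htq1 ht0 hT hI
  rw [Cor312Prov.negAbsLogQ_eq_neg_absLogq_of_isVolumeInputOf D hI]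
  have hle' := hle.trans (add_le_add hΘ le_rfl)
  rw [← WithTop.coe_add, WithTop.coe_le_coe] at hle'
  exact hle'

end Datum

/-! ## §2. T-LEVEL at the CHOSEN realising ideles: the universal adapter and its instances -/

section Chosen

open Literature.NumberTheory.DiophantineGeometry.GenEll Summit.ABC.ABC.Theorems Summit.ABC.IUTFork.Conditional

/-- **THE UNIVERSAL ADAPTER: «Cor. 3.12 up to `ε`» at the CHOSEN bed of a genuine Θ-volume datum `T` ⟹ `T.negAbsLogQ ≤ T.negLogTheta + ε`.** For every
`T : Cor22.ThetaVolumeDatumAt P l`, every context of abc-iut-c312-7's sharp print-normalised setting over `T.K` at `pilotDataOfK T.D T.K` with the CHOSEN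
realising ideles (`Cor312Prov.exists_realising_{q,theta}Ideles_pilotDataOfK`) and every `ε`: `StatementUpTo (setting) ε ⟹ T.negAbsLogQ ≤ T.negLogTheta + ε`
(§1 at `I := T.I`). Every generic door of the tree thereby discharges abc-iut-rh2-q2-cond's [NUMΣ-C] binder with `ε :=` its certified slack.
«holds AS TYPED for OUR hull»; no side taken. [cite: Mochizuki2012, IUTchIII Cor. 3.12 p. 173–174] [claim: Mochizuki2012, status: disputed] -/
theorem cor312UpTo_of_statementUpTo_chosen {P : NFPoint} {l : ℕ} (T : Cor22.ThetaVolumeDatumAt P l) :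
    letI := T.instFieldF; letI := T.instNumberFieldF; letI := T.instAlgebraF; letI := T.instFieldK;
        letI := T.instNumberFieldK; letI := T.instAlgebraK; letI := T.instFieldFbar; letI := T.instAlgebraFbar;
        letI := T.instAlgebraKFbar; letI := T.instIsElliptic;
    ∀ (M : Type) [Field M] [NumberField M]
      (archPk : ∀ (j : (thetaIndex (pilotDataOfK T.D T.K)).Label) (vQ : (thetaIndex (pilotDataOfK T.D T.K)).VQ),
        Set ((logShellsDH (pilotDataOfK T.D T.K) (analyticLogv T.K)).Packet j vQ))
      (archSub : ∀ (j : (thetaIndex (pilotDataOfK T.D T.K)).Label) (v : (thetaIndex (pilotDataOfK T.D T.K)).V),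
        Set ((logShellsDH (pilotDataOfK T.D T.K) (analyticLogv T.K)).Packet j ((thetaIndex (pilotDataOfK T.D T.K)).over v)))
      (Ψ : ℤ → ∀ v : (thetaIndex (pilotDataOfK T.D T.K)).V, v ∈ (thetaIndex (pilotDataOfK T.D T.K)).Vbad →
        Set ((logShellsDH (pilotDataOfK T.D T.K) (analyticLogv T.K)).StarPacket v))
      (act : ℤ → ∀ v : (thetaIndex (pilotDataOfK T.D T.K)).V, v ∈ (thetaIndex (pilotDataOfK T.D T.K)).Vbad →
        (logShellsDH (pilotDataOfK T.D T.K) (analyticLogv T.K)).StarPacket v →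
          Module.End ℚ ((logShellsDH (pilotDataOfK T.D T.K) (analyticLogv T.K)).StarPacket v))
      (Mmod : ℤ → ∀ j : (thetaIndex (pilotDataOfK T.D T.K)).LabelStar,
        Set ((logShellsDH (pilotDataOfK T.D T.K) (analyticLogv T.K)).GlobalPacket j.1))
      (region : ℤ → ∀ j : (thetaIndex (pilotDataOfK T.D T.K)).LabelStar, FinDivisor M →
        ∀ vQ : (thetaIndex (pilotDataOfK T.D T.K)).VQ, Set ((logShellsDH (pilotDataOfK T.D T.K) (analyticLogv T.K)).Packet j.1 vQ))
      (n : ℤ) {HT : Type} {LogLink : HT → HT → Type} {IsFull : ∀ {s t : HT}, LogLink s t → Prop}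
      (lat : LGPGaussianLogThetaLattice LogLink IsFull)
      {Frd : Type} {IsoF : Frd → Frd → Type} {Ob : Frd → Type} {realify : Frd → Frd} {Strip : Type}
      {IsoS : Strip → Strip → Type}
      {Mv : ∀ v : (thetaIndex (pilotDataOfK T.D T.K)).V, v ∈ (thetaIndex (pilotDataOfK T.D T.K)).Vbad → Type}
      [∀ v h, Monoid (Mv v h)]
      (sig : GlobalLGPFrobenioidSignature (thetaIndex (pilotDataOfK T.D T.K)).lstar (thetaIndex (pilotDataOfK T.D T.K)).V
        (· ∈ (thetaIndex (pilotDataOfK T.D T.K)).Vbad) Frd IsoF Ob realify Strip IsoS Mv)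
      (split : SplittingMonoids Mv) {ObΔ : Type}
      {N : ∀ v : (thetaIndex (pilotDataOfK T.D T.K)).V, v ∈ (thetaIndex (pilotDataOfK T.D T.K)).Vbad → Type} [∀ v h, Monoid (N v h)]
      (qData : QPilotData ObΔ N) (ε : ℝ),
      StatementUpTo
          (settingPrVolSharp (pilotDataOfK T.D T.K) (logvAnalytic_analyticLogv (F := T.K)) M archPk archSub Ψ act Mmod region n lat
            sig split qData (exists_realising_qIdeles_pilotDataOfK T.D).choose (exists_realising_thetaIdeles_pilotDataOfK T.D).choose
            (exists_realising_qIdeles_pilotDataOfK T.D).choose_spec.1 (exists_realising_qIdeles_pilotDataOfK T.D).choose_spec.2.1) ε →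
      T.negAbsLogQ ≤ T.negLogTheta + ε := by
  intro M _ _ archPk archSub Ψ act Mmod region n HT LogLink IsFull lat Frd IsoF Ob realify Strip IsoS Mv _ sig split ObΔ N _ qData ε hst
  letI := T.instFieldF; letI := T.instNumberFieldF; letI := T.instAlgebraF; letI := T.instFieldK
  letI := T.instNumberFieldK; letI := T.instAlgebraK; letI := T.instFieldFbar; letI := T.instAlgebraFbar
  letI := T.instAlgebraKFbar; letI := T.instIsElliptic
  exact GenuineK.cor312UpTo_of_statementUpTo T.D M archPk archSub Ψ act Mmod region n lat sig split qData
    (exists_realising_qIdeles_pilotDataOfK T.D).choose (exists_realising_thetaIdeles_pilotDataOfK T.D).choose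
    (exists_realising_qIdeles_pilotDataOfK T.D).choose_spec.1 (exists_realising_qIdeles_pilotDataOfK T.D).choose_spec.2.1
    T.isVolumeInputOf (exists_realising_thetaIdeles_pilotDataOfK T.D).choose_spec.1
    (exists_realising_qIdeles_pilotDataOfK T.D).choose_spec.2.2 (exists_realising_thetaIdeles_pilotDataOfK T.D).choose_spec.2.2 hst

/-- **THE WEIGHTED DOOR AT THE DATUM** (p480491 ∘ the adapter): at the chosen bed of `T`, a weight `ω ≤ 1` with `weightedDeficit (setting) ω ≤ 0` gives
`T.negAbsLogQ ≤ T.negLogTheta + weightedTrivialMass (setting) ω`. «holds AS TYPED»; the aggregate sign condition is an assumption shape; no side taken.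
[cite: Mochizuki2012, IUTchIII Cor. 3.12 p. 173–174] [claim: Mochizuki2012, status: disputed] -/
theorem cor312UpTo_weightedTrivialMass_of_weightedDeficit_nonpos_chosen {P : NFPoint} {l : ℕ} (T : Cor22.ThetaVolumeDatumAt P l) :
    letI := T.instFieldF; letI := T.instNumberFieldF; letI := T.instAlgebraF; letI := T.instFieldK;
        letI := T.instNumberFieldK; letI := T.instAlgebraK; letI := T.instFieldFbar; letI := T.instAlgebraFbar;
        letI := T.instAlgebraKFbar; letI := T.instIsElliptic;
    ∀ (M : Type) [Field M] [NumberField M]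
      (archPk : ∀ (j : (thetaIndex (pilotDataOfK T.D T.K)).Label) (vQ : (thetaIndex (pilotDataOfK T.D T.K)).VQ),
        Set ((logShellsDH (pilotDataOfK T.D T.K) (analyticLogv T.K)).Packet j vQ))
      (archSub : ∀ (j : (thetaIndex (pilotDataOfK T.D T.K)).Label) (v : (thetaIndex (pilotDataOfK T.D T.K)).V),
        Set ((logShellsDH (pilotDataOfK T.D T.K) (analyticLogv T.K)).Packet j ((thetaIndex (pilotDataOfK T.D T.K)).over v)))
      (Ψ : ℤ → ∀ v : (thetaIndex (pilotDataOfK T.D T.K)).V, v ∈ (thetaIndex (pilotDataOfK T.D T.K)).Vbad →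
        Set ((logShellsDH (pilotDataOfK T.D T.K) (analyticLogv T.K)).StarPacket v))
      (act : ℤ → ∀ v : (thetaIndex (pilotDataOfK T.D T.K)).V, v ∈ (thetaIndex (pilotDataOfK T.D T.K)).Vbad →
        (logShellsDH (pilotDataOfK T.D T.K) (analyticLogv T.K)).StarPacket v →
          Module.End ℚ ((logShellsDH (pilotDataOfK T.D T.K) (analyticLogv T.K)).StarPacket v))
      (Mmod : ℤ → ∀ j : (thetaIndex (pilotDataOfK T.D T.K)).LabelStar,
        Set ((logShellsDH (pilotDataOfK T.D T.K) (analyticLogv T.K)).GlobalPacket j.1))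
      (region : ℤ → ∀ j : (thetaIndex (pilotDataOfK T.D T.K)).LabelStar, FinDivisor M →
        ∀ vQ : (thetaIndex (pilotDataOfK T.D T.K)).VQ, Set ((logShellsDH (pilotDataOfK T.D T.K) (analyticLogv T.K)).Packet j.1 vQ))
      (n : ℤ) {HT : Type} {LogLink : HT → HT → Type} {IsFull : ∀ {s t : HT}, LogLink s t → Prop}
      (lat : LGPGaussianLogThetaLattice LogLink IsFull)
      {Frd : Type} {IsoF : Frd → Frd → Type} {Ob : Frd → Type} {realify : Frd → Frd} {Strip : Type}
      {IsoS : Strip → Strip → Type}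
      {Mv : ∀ v : (thetaIndex (pilotDataOfK T.D T.K)).V, v ∈ (thetaIndex (pilotDataOfK T.D T.K)).Vbad → Type}
      [∀ v h, Monoid (Mv v h)]
      (sig : GlobalLGPFrobenioidSignature (thetaIndex (pilotDataOfK T.D T.K)).lstar (thetaIndex (pilotDataOfK T.D T.K)).V
        (· ∈ (thetaIndex (pilotDataOfK T.D T.K)).Vbad) Frd IsoF Ob realify Strip IsoS Mv)
      (split : SplittingMonoids Mv) {ObΔ : Type}
      {N : ∀ v : (thetaIndex (pilotDataOfK T.D T.K)).V, v ∈ (thetaIndex (pilotDataOfK T.D T.K)).Vbad → Type} [∀ v h, Monoid (N v h)]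
      (qData : QPilotData ObΔ N)
      (ω : Fin (thetaIndex (pilotDataOfK T.D T.K)).lstar × (thetaIndex (pilotDataOfK T.D T.K)).VQ → ℝ),
      (∀ c, ω c ≤ 1) →
      weightedDeficit
          (settingPrVolSharp (pilotDataOfK T.D T.K) (logvAnalytic_analyticLogv (F := T.K)) M archPk archSub Ψ act Mmod region n lat
            sig split qData (exists_realising_qIdeles_pilotDataOfK T.D).choose (exists_realising_thetaIdeles_pilotDataOfK T.D).choose
            (exists_realising_qIdeles_pilotDataOfK T.D).choose_spec.1 (exists_realising_qIdeles_pilotDataOfK T.D).choose_spec.2.1) ω ≤ 0 →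
      T.negAbsLogQ ≤ T.negLogTheta +
        weightedTrivialMass
          (settingPrVolSharp (pilotDataOfK T.D T.K) (logvAnalytic_analyticLogv (F := T.K)) M archPk archSub Ψ act Mmod region n lat
            sig split qData (exists_realising_qIdeles_pilotDataOfK T.D).choose (exists_realising_thetaIdeles_pilotDataOfK T.D).choose
            (exists_realising_qIdeles_pilotDataOfK T.D).choose_spec.1 (exists_realising_qIdeles_pilotDataOfK T.D).choose_spec.2.1) ω := by
  intro M _ _ archPk archSub Ψ act Mmod region n HT LogLink IsFull lat Frd IsoF Ob realify Strip IsoS Mv _ sig split ObΔ N _ qData ω hω h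
  letI := T.instFieldF; letI := T.instNumberFieldF; letI := T.instAlgebraF; letI := T.instFieldK
  letI := T.instNumberFieldK; letI := T.instAlgebraK; letI := T.instFieldFbar; letI := T.instAlgebraFbar
  letI := T.instAlgebraKFbar; letI := T.instIsElliptic
  have H := bridgeHyps_settingPrVolSharp_of_ideles (pilotDataOfK T.D T.K) (logvAnalytic_analyticLogv (F := T.K)) M archPk archSub Ψ act
    Mmod region n lat sig split qData (exists_realising_thetaIdeles_pilotDataOfK T.D).choose (exists_realising_qIdeles_pilotDataOfK T.D).choose
    (exists_realising_thetaIdeles_pilotDataOfK T.D).choose_spec.1 (exists_realising_thetaIdeles_pilotDataOfK T.D).choose_spec.2.1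
    (exists_realising_qIdeles_pilotDataOfK T.D).choose_spec.1 (exists_realising_qIdeles_pilotDataOfK T.D).choose_spec.2.1
  exact cor312UpTo_of_statementUpTo_chosen T M archPk archSub Ψ act Mmod region n lat sig split qData _
    (statementUpTo_weightedTrivialMass_of_weightedDeficit_nonpos H hω h)

/-- **THE LEAST SLACK AT THE DATUM, hypothesis-free** (p479556 `statementUpTo_avg_cellDeficit` ∘ the adapter): at the chosen bed of EVERY genuine Θ-volume
datum, `T.negAbsLogQ ≤ T.negLogTheta + D(T)` with `D(T) = signedRemainder (setting) = R_∅(T) − C(T)` — sharper than p476845's `cor312UpTo_offRemainder_empty_chosen`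
by exactly the credit. «holds AS TYPED»; no side taken. [cite: Mochizuki2012, IUTchIII Cor. 3.12 p. 173–174] [claim: Mochizuki2012, status: disputed] -/
theorem cor312UpTo_signedRemainder_chosen {P : NFPoint} {l : ℕ} (T : Cor22.ThetaVolumeDatumAt P l) :
    letI := T.instFieldF; letI := T.instNumberFieldF; letI := T.instAlgebraF; letI := T.instFieldK;
        letI := T.instNumberFieldK; letI := T.instAlgebraK; letI := T.instFieldFbar; letI := T.instAlgebraFbar;
        letI := T.instAlgebraKFbar; letI := T.instIsElliptic;
    ∀ (M : Type) [Field M] [NumberField M]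
      (archPk : ∀ (j : (thetaIndex (pilotDataOfK T.D T.K)).Label) (vQ : (thetaIndex (pilotDataOfK T.D T.K)).VQ),
        Set ((logShellsDH (pilotDataOfK T.D T.K) (analyticLogv T.K)).Packet j vQ))
      (archSub : ∀ (j : (thetaIndex (pilotDataOfK T.D T.K)).Label) (v : (thetaIndex (pilotDataOfK T.D T.K)).V),
        Set ((logShellsDH (pilotDataOfK T.D T.K) (analyticLogv T.K)).Packet j ((thetaIndex (pilotDataOfK T.D T.K)).over v)))
      (Ψ : ℤ → ∀ v : (thetaIndex (pilotDataOfK T.D T.K)).V, v ∈ (thetaIndex (pilotDataOfK T.D T.K)).Vbad →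
        Set ((logShellsDH (pilotDataOfK T.D T.K) (analyticLogv T.K)).StarPacket v))
      (act : ℤ → ∀ v : (thetaIndex (pilotDataOfK T.D T.K)).V, v ∈ (thetaIndex (pilotDataOfK T.D T.K)).Vbad →
        (logShellsDH (pilotDataOfK T.D T.K) (analyticLogv T.K)).StarPacket v →
          Module.End ℚ ((logShellsDH (pilotDataOfK T.D T.K) (analyticLogv T.K)).StarPacket v))
      (Mmod : ℤ → ∀ j : (thetaIndex (pilotDataOfK T.D T.K)).LabelStar,
        Set ((logShellsDH (pilotDataOfK T.D T.K) (analyticLogv T.K)).GlobalPacket j.1))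
      (region : ℤ → ∀ j : (thetaIndex (pilotDataOfK T.D T.K)).LabelStar, FinDivisor M →
        ∀ vQ : (thetaIndex (pilotDataOfK T.D T.K)).VQ, Set ((logShellsDH (pilotDataOfK T.D T.K) (analyticLogv T.K)).Packet j.1 vQ))
      (n : ℤ) {HT : Type} {LogLink : HT → HT → Type} {IsFull : ∀ {s t : HT}, LogLink s t → Prop}
      (lat : LGPGaussianLogThetaLattice LogLink IsFull)
      {Frd : Type} {IsoF : Frd → Frd → Type} {Ob : Frd → Type} {realify : Frd → Frd} {Strip : Type}
      {IsoS : Strip → Strip → Type}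
      {Mv : ∀ v : (thetaIndex (pilotDataOfK T.D T.K)).V, v ∈ (thetaIndex (pilotDataOfK T.D T.K)).Vbad → Type}
      [∀ v h, Monoid (Mv v h)]
      (sig : GlobalLGPFrobenioidSignature (thetaIndex (pilotDataOfK T.D T.K)).lstar (thetaIndex (pilotDataOfK T.D T.K)).V
        (· ∈ (thetaIndex (pilotDataOfK T.D T.K)).Vbad) Frd IsoF Ob realify Strip IsoS Mv)
      (split : SplittingMonoids Mv) {ObΔ : Type}
      {N : ∀ v : (thetaIndex (pilotDataOfK T.D T.K)).V, v ∈ (thetaIndex (pilotDataOfK T.D T.K)).Vbad → Type} [∀ v h, Monoid (N v h)]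
      (qData : QPilotData ObΔ N),
      T.negAbsLogQ ≤ T.negLogTheta +
        signedRemainder
          (settingPrVolSharp (pilotDataOfK T.D T.K) (logvAnalytic_analyticLogv (F := T.K)) M archPk archSub Ψ act Mmod region n lat
            sig split qData (exists_realising_qIdeles_pilotDataOfK T.D).choose (exists_realising_thetaIdeles_pilotDataOfK T.D).choose
            (exists_realising_qIdeles_pilotDataOfK T.D).choose_spec.1 (exists_realising_qIdeles_pilotDataOfK T.D).choose_spec.2.1) := by
  intro M _ _ archPk archSub Ψ act Mmod region n HT LogLink IsFull lat Frd IsoF Ob realify Strip IsoS Mv _ sig split ObΔ N _ qData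
  letI := T.instFieldF; letI := T.instNumberFieldF; letI := T.instAlgebraF; letI := T.instFieldK
  letI := T.instNumberFieldK; letI := T.instAlgebraK; letI := T.instFieldFbar; letI := T.instAlgebraFbar
  letI := T.instAlgebraKFbar; letI := T.instIsElliptic
  have H := bridgeHyps_settingPrVolSharp_of_ideles (pilotDataOfK T.D T.K) (logvAnalytic_analyticLogv (F := T.K)) M archPk archSub Ψ act
    Mmod region n lat sig split qData (exists_realising_thetaIdeles_pilotDataOfK T.D).choose (exists_realising_qIdeles_pilotDataOfK T.D).choose
    (exists_realising_thetaIdeles_pilotDataOfK T.D).choose_spec.1 (exists_realising_thetaIdeles_pilotDataOfK T.D).choose_spec.2.1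
    (exists_realising_qIdeles_pilotDataOfK T.D).choose_spec.1 (exists_realising_qIdeles_pilotDataOfK T.D).choose_spec.2.1
  exact cor312UpTo_of_statementUpTo_chosen T M archPk archSub Ψ act Mmod region n lat sig split qData _
    (statementUpTo_signedRemainder H)

end Chosen

end Summit.ABC.IUTFork.Repair.RH.SigmaStrataEq

end
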